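import Summits.QuantumFields.YangMills.Theorems.VirialFluxGapSharpTwistedLaplaceDetBounds
import Mathlib.Analysis.InnerProductSpace.Basic
import Mathlib.Analysis.SpecialFunctions.Pow.Real
import HarnessLib

/-!
# Log-bookkeeping of the orbit coefficient `c = A₀·c₀^N / (c_ν·√det A)` and an upper quadratic bound from the phase expansion
# (inputs `hc ∕ hΛ` of ✓`sharpTwistedLaplace_of_fixTubes`, ⟨stmt-QuantumFields-24204⟩ `VirialFluxGap.SharpTwistedLaplace`)

Helper module (free-hands work of width seat ym-line-sfw-p2-w3 g57, cell ym-idea-1; `--supports 24204`).  The per-tube coefficient of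
✓`FixSplit.fix_htube_final` is `c = A₀ (2π²)^{−N} / (c_ν √det A)`; ✓`sharpTwistedLaplace_of_fixTubes` wants `|log Σ_s c_s| ≤ A·L^p`.
* `inner_le_of_quadratic_bound` — if `½⟪Av,v⟫ ≤ M` on the ball `‖v‖ ≤ R` (`R > 0`; e.g. from the phase expansion `hf` and a bound on the phase) then
  `⟪Av,v⟫ ≤ (2M/R²)‖v‖²` everywhere (scaling) — the upper bound `Λ` needed by ✓`QuantitativeLaplace.abs_log_det_le`;
* ★ `abs_log_orbitCoeff_le` — `|log(A₀ c₀^N/(c_ν √det A))| ≤ |log A₀| + N|log c₀| + |log c_ν| + (n/2)·max(|log λ|, |log Λ|)` for a symmetric `A` with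
  `λ‖v‖² ≤ ⟪Av,v⟫ ≤ Λ‖v‖²`, `n = finrank V`.
Everything here is PROVED; no definitions, no named facts.  HONEST FRAMING: bookkeeping; ⟨24204⟩, ⟨24319⟩ and every rung stay OPEN; the Yang–Mills
mass gap (Clay) is NOT touched; no summit is proved by a line.

## References
* K. W. Breitung, *Asymptotic Approximations for Probability Integrals*, LNM 1592 (1994), Thm 41 p. 56. [Breitung1994]
-/

set_option autoImplicit false

noncomputable section

open Module
open scoped InnerProductSpace

namespace Summit.QuantumFields.YangMills.Theorems.VirialFluxGap.FixSplit

variable {V : Type*} [NormedAddCommGroup V] [InnerProductSpace ℝ V]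

/-- **Scaling**: a bound `½⟪Av,v⟫ ≤ M` on the ball of radius `R` gives `⟪Av,v⟫ ≤ (2M/R²)‖v‖²` everywhere. [folklore] -/
theorem inner_le_of_quadratic_bound (A : V →ₗ[ℝ] V) {R M : ℝ} (hR : 0 < R)
    (hM : ∀ v : V, ‖v‖ ≤ R → (1 / 2) * ⟪A v, v⟫_ℝ ≤ M) (v : V) : ⟪A v, v⟫_ℝ ≤ 2 * M / R ^ 2 * ‖v‖ ^ 2 := by
  by_cases hv : v = 0
  · subst hv; simp
  have hv0 : 0 < ‖v‖ := norm_pos_iff.mpr hv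
  set t : ℝ := R / ‖v‖ with ht
  have ht0 : 0 < t := div_pos hR hv0
  have hu : ‖t • v‖ ≤ R := by
    rw [norm_smul, Real.norm_eq_abs, abs_of_pos ht0, ht, div_mul_cancel₀ _ hv0.ne']
  have hq : ⟪A (t • v), t • v⟫_ℝ = t ^ 2 * ⟪A v, v⟫_ℝ := by
    rw [map_smul, inner_smul_left, inner_smul_right]
    simp only [conj_trivial]
    ring
  have h := hM (t • v) hu
  rw [hq] at h
  have ht2 : t ^ 2 = R ^ 2 / ‖v‖ ^ 2 := by rw [ht, div_pow]
  rw [ht2] at h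
  have hv2 : 0 < ‖v‖ ^ 2 := by positivity
  have hR2 : 0 < R ^ 2 := by positivity
  have h' : R ^ 2 * ⟪A v, v⟫_ℝ ≤ 2 * M * ‖v‖ ^ 2 := by
    have := mul_le_mul_of_nonneg_left h (le_of_lt (mul_pos two_pos hv2))
    have e : 2 * ‖v‖ ^ 2 * (1 / 2 * (R ^ 2 / ‖v‖ ^ 2 * ⟪A v, v⟫_ℝ)) = R ^ 2 * ⟪A v, v⟫_ℝ := by
      field_simp
    linarith [e.symm.le, e.le]
  rw [div_mul_eq_mul_div, le_div_iff₀ hR2]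
  linarith

variable [FiniteDimensional ℝ V]

/-- ★ **Log-bookkeeping of the orbit coefficient**: for a symmetric `A` with `λ‖v‖² ≤ ⟪Av,v⟫ ≤ Λ‖v‖²` (`λ > 0`) and positive `A₀, c₀, c_ν`,
`|log(A₀ c₀^N /c_ν /√det A)| ≤ |log A₀| + N|log c₀| + |log c_ν| + (n/2)·max(|log λ|, |log Λ|)`. [cite: Breitung1994, Thm 41 p. 56] -/
theorem abs_log_orbitCoeff_le {A : V →ₗ[ℝ] V} (hA : A.IsSymmetric) {lam Λ : ℝ} (hlam : 0 < lam)
    (hlo : ∀ y : V, lam * ‖y‖ ^ 2 ≤ ⟪A y, y⟫_ℝ) (hhi : ∀ y : V, ⟪A y, y⟫_ℝ ≤ Λ * ‖y‖ ^ 2)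
    {A₀ c₀ cν : ℝ} (hA₀ : 0 < A₀) (hc₀ : 0 < c₀) (hcν : 0 < cν) (N : ℕ) :
    |Real.log (A₀ * c₀ ^ N / cν / Real.sqrt (LinearMap.det A))| ≤
      |Real.log A₀| + N * |Real.log c₀| + |Real.log cν| + (finrank ℝ V : ℝ) / 2 * max |Real.log lam| |Real.log Λ| := by
  have hdet : 0 < LinearMap.det A := lt_of_lt_of_le (pow_pos hlam _) (QuantitativeLaplace.pow_le_det_of_coercive hA hlam.le hlo)
  have hsq : 0 < Real.sqrt (LinearMap.det A) := Real.sqrt_pos.mpr hdet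
  have hlogdet := QuantitativeLaplace.abs_log_det_le hA hlam hlo hhi
  rw [Real.log_div (by positivity) hsq.ne', Real.log_div (by positivity) hcν.ne', Real.log_mul hA₀.ne' (pow_pos hc₀ N).ne',
    Real.log_pow, Real.log_sqrt hdet.le]
  have h1 : |Real.log A₀ + N * Real.log c₀ - Real.log cν - Real.log (LinearMap.det A) / 2| ≤
      |Real.log A₀| + |N * Real.log c₀| + |Real.log cν| + |Real.log (LinearMap.det A) / 2| := by
    have e1 := abs_sub (Real.log A₀ + N * Real.log c₀ - Real.log cν) (Real.log (LinearMap.det A) / 2)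
    have e2 := abs_sub (Real.log A₀ + N * Real.log c₀) (Real.log cν)
    have e3 := abs_add_le (Real.log A₀) (N * Real.log c₀)
    linarith
  have h2 : |(N : ℝ) * Real.log c₀| = N * |Real.log c₀| := by
    rw [abs_mul, Nat.abs_cast]
  have h3 : |Real.log (LinearMap.det A) / 2| ≤ (finrank ℝ V : ℝ) / 2 * max |Real.log lam| |Real.log Λ| := by
    rw [abs_div, abs_two]
    linarith
  linarith [h1, h2.le, h2.ge, h3]

end Summit.QuantumFields.YangMills.Theorems.VirialFluxGap.FixSplit

end
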